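import Mathlib
import Literature.Analysis.FluidPDE.GaussianVortexPlanar
import Literature.Analysis.FluidPDE.GaussianVortexPlanarProofs
import Literature.Analysis.FluidPDE.BiotSavart2DSymmetry
import Literature.Analysis.ODE.ConstCoeffL2Vanishing
import Summits.AnomalousDissipation.AnomalousDissipation.Theorems.MarginalStabilityChainStretchedVortexRowsStubCellSolvabilityTools
import Summits.AnomalousDissipation.AnomalousDissipation.Theorems.MarginalStabilityChainStretchedVortexRowsStubHardyWirtingerEven
import Summits.AnomalousDissipation.AnomalousDissipation.Theorems.MarginalStabilityChainStretchedVortexRowsStubCircAvgTools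
import HarnessLib

/-!
# Circular-mean toolkit (II) toward stub `stub_coreInverse` of the line `braid-closed-large-circulation-gluing`
# (crux stmt-AnomalousDissipation-3009, `MarginalStabilityChain.StretchedVortexRows`)

Part II of the circular-mean toolkit (part I: `…StubCircAvgTools`, radiality and regularity of
`u₀(ξ) = (2π)⁻¹ ∫₀^{2π} u(cos t · ξ + sin t · ξ^⊥) dt`). Here: the integral facts used by the energy method for
`stub_coreInverse` (helper `circAvg_wirtinger_even` and the background pairing `lamB_pairing_w_bound`):

* mean and variance on an interval: `∫ₐᵇ (f − m)² = ∫ₐᵇ f² − (∫ₐᵇ f)²/(b − a)` for the mean `m`, hence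
  `∫ₐᵇ (f − m)² ≤ ∫ₐᵇ f²` (Jensen `(∫ₐᵇ f)² ≤ (b − a)∫ₐᵇ f²` is the tree's `Literature.Analysis.ODE.sq_intervalIntegral_le`);
* **T4, zero circular means of the remainder**: `∫₀^{2π} (u − u₀)(r cos θ, r sin θ) dθ = 0` for every `r`
  (`intervalIntegral_sub_circularMean_eq_zero`, registered form `circAvg_sub_circularMean_zero`), also over `[−π, π]`;
* **comparison circle by circle** (`integral_le_integral_of_forall_circle`): for continuous nonnegative `F₁, F₂` with
  `F₂ ∈ L¹`, circle-wise inequalities `∫_{−π}^{π} F₁(γ_r) ≤ ∫_{−π}^{π} F₂(γ_r)` (`r > 0`) integrate to `F₁ ∈ L¹` and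
  `∫ F₁ ≤ ∫ F₂` — polar coordinates for lower Lebesgue integrals (landed `lintegral_eq_lintegral_polar`) and Tonelli;
* **T5, `L²` contraction for radial weights**: `∫ ρ u₀² ≤ ∫ ρ u²` and `∫ ρ (u − u₀)² ≤ ∫ ρ u²` for continuous `u` and a
  continuous nonnegative radial weight `ρ` with `ρ u² ∈ L¹` (e.g. `ρ = G`, `ρ = G Ω`), with the integrability of the
  left-hand sides (Jensen on each circle, where `ρ` and `u₀` are constant, then the comparison principle).

References: Th. Gallay, C. E. Wayne, Comm. Math. Phys. 255 (2005) §4.1; G. H. Hardy, J. E. Littlewood, G. Pólya,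
*Inequalities*, Thm. 258.
-/

set_option linter.dupNamespace false

noncomputable section

open scoped RealInnerProductSpace Topology ENNReal
open MeasureTheory WithLp Function Set Real intervalIntegral Filter

namespace Summit.AnomalousDissipation.AnomalousDissipation.Theorems.MarginalStabilityChainStretchedVortexRows

open Literature.Analysis.FluidPDE

/-! ### Mean and variance on an interval -/

/-- **Variance identity on an interval**: for continuous `f` and `a < b`, with the mean `m = (b − a)⁻¹ ∫ₐᵇ f`,
`∫ₐᵇ (f − m)² = ∫ₐᵇ f² − (∫ₐᵇ f)²/(b − a)`. [folklore] -/
theorem intervalIntegral_sub_mean_sq {f : ℝ → ℝ} (hf : Continuous f) {a b : ℝ} (hab : a < b) :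
    ∫ x in a..b, (f x - (b - a)⁻¹ * ∫ y in a..b, f y) ^ 2 =
      (∫ x in a..b, f x ^ 2) - (b - a)⁻¹ * (∫ x in a..b, f x) ^ 2 := by
  set I : ℝ := ∫ y in a..b, f y with hI
  set m : ℝ := (b - a)⁻¹ * I with hm
  have hL : b - a ≠ 0 := (sub_pos.2 hab).ne'
  have e : ∀ x, (f x - m) ^ 2 = f x ^ 2 - (2 * m) * f x + m ^ 2 := fun x => by ring
  simp_rw [e]
  have hi1 : IntervalIntegrable (fun x => f x ^ 2) volume a b := (hf.pow 2).intervalIntegrable _ _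
  have hi2 : IntervalIntegrable (fun x => (2 * m) * f x) volume a b := (hf.const_mul _).intervalIntegrable _ _
  rw [intervalIntegral.integral_add (hi1.sub hi2) intervalIntegrable_const,
    intervalIntegral.integral_sub hi1 hi2, intervalIntegral.integral_const_mul, intervalIntegral.integral_const,
    smul_eq_mul, ← hI, hm]
  field_simp
  ring

/-- **Subtracting the mean does not increase the `L²` norm**: `∫ₐᵇ (f − m)² ≤ ∫ₐᵇ f²`, `m` the mean of `f`. [folklore] -/
theorem intervalIntegral_sub_mean_sq_le {f : ℝ → ℝ} (hf : Continuous f) {a b : ℝ} (hab : a < b) :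
    ∫ x in a..b, (f x - (b - a)⁻¹ * ∫ y in a..b, f y) ^ 2 ≤ ∫ x in a..b, f x ^ 2 := by
  rw [intervalIntegral_sub_mean_sq hf hab, sub_le_self_iff]
  exact mul_nonneg (inv_nonneg.2 (sub_pos.2 hab).le) (sq_nonneg _)

/-! ### Circle integrals over `[0, 2π]` and `[−π, π]` -/

/-- The angular integral of a function on the circle of radius `r` may be taken over `[0, 2π]` or `[−π, π]`. [folklore] -/
theorem intervalIntegral_circle_zero_two_pi_eq (u : EuclideanSpace ℝ (Fin 2) → ℝ) (r : ℝ) :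
    ∫ θ in (0:ℝ)..2 * π, u (toLp 2 ![r * Real.cos θ, r * Real.sin θ]) =
      ∫ θ in (-π)..π, u (toLp 2 ![r * Real.cos θ, r * Real.sin θ]) := by
  have hper : Periodic (fun t => u (toLp 2 ![r * Real.cos t, r * Real.sin t])) (2 * π) := fun t => by
    simp only [Real.cos_add_two_pi, Real.sin_add_two_pi]
  have h := hper.intervalIntegral_add_eq 0 (-π)
  rwa [zero_add, show -π + 2 * π = π by ring] at h

/-- **T4: the remainder `u − u₀` has zero circular means** (angular integral over `[0, 2π]`). [folklore] -/
theorem intervalIntegral_sub_circularMean_eq_zero {u u₀ : EuclideanSpace ℝ (Fin 2) → ℝ}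
    (hu₀ : u₀ = fun ξ => (2 * π)⁻¹ * ∫ t in (0:ℝ)..2 * π, u (Real.cos t • ξ + Real.sin t • perp ξ))
    (hu : Continuous u) (r : ℝ) :
    ∫ θ in (0:ℝ)..2 * π, (u (toLp 2 ![r * Real.cos θ, r * Real.sin θ]) -
      u₀ (toLp 2 ![r * Real.cos θ, r * Real.sin θ])) = 0 := by
  simp_rw [circularMean_circlePoint hu₀ r]
  have hi : IntervalIntegrable (fun θ => u (toLp 2 ![r * Real.cos θ, r * Real.sin θ])) volume 0 (2 * π) :=
    (hu.comp (continuous_toLp_cos_sin r)).intervalIntegrable _ _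
  rw [intervalIntegral.integral_sub hi intervalIntegrable_const, intervalIntegral.integral_const, smul_eq_mul,
    sub_zero]
  field_simp
  ring

/-- **T4 over `[−π, π]`**: `∫_{−π}^{π} (u − u₀)(r cos θ, r sin θ) dθ = 0`. [folklore] -/
theorem intervalIntegral_sub_circularMean_eq_zero' {u u₀ : EuclideanSpace ℝ (Fin 2) → ℝ}
    (hu₀ : u₀ = fun ξ => (2 * π)⁻¹ * ∫ t in (0:ℝ)..2 * π, u (Real.cos t • ξ + Real.sin t • perp ξ))
    (hu : Continuous u) (r : ℝ) :
    ∫ θ in (-π)..π, (u (toLp 2 ![r * Real.cos θ, r * Real.sin θ]) -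
      u₀ (toLp 2 ![r * Real.cos θ, r * Real.sin θ])) = 0 := by
  rw [← intervalIntegral_circle_zero_two_pi_eq (fun ξ => u ξ - u₀ ξ) r]
  exact intervalIntegral_sub_circularMean_eq_zero hu₀ hu r

/-- **T4 (registered form): the remainder after subtracting the circular mean has zero circular means.** [folklore] -/
theorem circAvg_sub_circularMean_zero :
    ∀ u : EuclideanSpace ℝ (Fin 2) → ℝ, Continuous u → ∀ r : ℝ,
      ∫ θ in (0:ℝ)..(2 * Real.pi), (u (toLp 2 ![r * Real.cos θ, r * Real.sin θ]) -
        (2 * Real.pi)⁻¹ * ∫ t in (0:ℝ)..(2 * Real.pi),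
          u (Real.cos t • toLp 2 ![r * Real.cos θ, r * Real.sin θ] +
            Real.sin t • perp (toLp 2 ![r * Real.cos θ, r * Real.sin θ]))) = 0 :=
  fun u hu r => intervalIntegral_sub_circularMean_eq_zero (u := u) rfl hu r

/-! ### Comparison circle by circle (polar coordinates) -/

/-- **Comparison principle, circle by circle.** For continuous nonnegative `F₁, F₂` on `ℝ²` with `F₂` integrable: if
`∫_{−π}^{π} F₁(r cos θ, r sin θ) dθ ≤ ∫_{−π}^{π} F₂(r cos θ, r sin θ) dθ` for every `r > 0`, then `F₁` is integrable and
`∫ F₁ ≤ ∫ F₂` (polar coordinates for lower integrals, landed `lintegral_eq_lintegral_polar`, and Tonelli). [folklore] -/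
theorem integral_le_integral_of_forall_circle {F₁ F₂ : EuclideanSpace ℝ (Fin 2) → ℝ}
    (h₁ : Continuous F₁) (h₂ : Continuous F₂) (h₁0 : ∀ ξ, 0 ≤ F₁ ξ) (h₂0 : ∀ ξ, 0 ≤ F₂ ξ)
    (hint : Integrable F₂)
    (hle : ∀ r, 0 < r → ∫ θ in (-π)..π, F₁ (toLp 2 ![r * Real.cos θ, r * Real.sin θ]) ≤
      ∫ θ in (-π)..π, F₂ (toLp 2 ![r * Real.cos θ, r * Real.sin θ])) :
    Integrable F₁ ∧ ∫ ξ, F₁ ξ ≤ ∫ ξ, F₂ ξ := by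
  have hI : ∀ {F : EuclideanSpace ℝ (Fin 2) → ℝ}, Continuous F → ∀ r : ℝ,
      IntegrableOn (fun θ => F (toLp 2 ![r * Real.cos θ, r * Real.sin θ])) (Ioo (-π) π) := fun hF r =>
    ((hF.comp (continuous_toLp_cos_sin r)).integrableOn_Icc).mono_set Ioo_subset_Icc_self
  have hslice : ∀ r, 0 < r →
      ∫⁻ θ in Ioo (-π) π, ENNReal.ofReal r * ENNReal.ofReal (F₁ (toLp 2 ![r * Real.cos θ, r * Real.sin θ])) ≤
        ∫⁻ θ in Ioo (-π) π, ENNReal.ofReal r * ENNReal.ofReal (F₂ (toLp 2 ![r * Real.cos θ, r * Real.sin θ])) := by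
    intro r hr
    rw [lintegral_const_mul' _ _ ENNReal.ofReal_ne_top, lintegral_const_mul' _ _ ENNReal.ofReal_ne_top]
    refine mul_le_mul_right ?_ _
    rw [← ofReal_integral_eq_lintegral_ofReal (hI h₁ r) (Eventually.of_forall fun θ => h₁0 _),
      ← ofReal_integral_eq_lintegral_ofReal (hI h₂ r) (Eventually.of_forall fun θ => h₂0 _)]
    refine ENNReal.ofReal_le_ofReal ?_
    rw [← integral_Ioc_eq_integral_Ioo, ← intervalIntegral.integral_of_le (by linarith [pi_pos]),
      ← integral_Ioc_eq_integral_Ioo, ← intervalIntegral.integral_of_le (by linarith [pi_pos])]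
    exact hle r hr
  have hle' : ∫⁻ ξ, ENNReal.ofReal (F₁ ξ) ≤ ∫⁻ ξ, ENNReal.ofReal (F₂ ξ) := by
    rw [lintegral_eq_lintegral_polar _ h₁.measurable.ennreal_ofReal,
      lintegral_eq_lintegral_polar _ h₂.measurable.ennreal_ofReal]
    exact setLIntegral_mono' measurableSet_Ioi fun r hr => hslice r hr
  have hfin : ∫⁻ ξ, ENNReal.ofReal (F₂ ξ) < ⊤ := hint.lintegral_lt_top
  have hF₁ : Integrable F₁ :=
    ⟨h₁.aestronglyMeasurable, (hasFiniteIntegral_iff_ofReal (Eventually.of_forall h₁0)).2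
      (lt_of_le_of_lt hle' hfin)⟩
  refine ⟨hF₁, ?_⟩
  rw [integral_eq_lintegral_of_nonneg_ae (Eventually.of_forall h₁0) h₁.aestronglyMeasurable,
    integral_eq_lintegral_of_nonneg_ae (Eventually.of_forall h₂0) h₂.aestronglyMeasurable]
  exact ENNReal.toReal_mono hfin.ne hle'

/-! ### The circular mean is an `L²` contraction for radial weights -/

/-- **T5: `∫ ρ u₀² ≤ ∫ ρ u²`** for a continuous, nonnegative, RADIAL weight `ρ` with `ρ u² ∈ L¹` and continuous `u`
(Jensen on each circle, where `ρ` and `u₀` are constant, then the comparison principle); in particular `ρ u₀² ∈ L¹`.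
Typical weights: `ρ = G`, `ρ = G Ω`. [folklore] -/
theorem integral_mul_circularMean_sq_le {u u₀ ρ : EuclideanSpace ℝ (Fin 2) → ℝ}
    (hu₀ : u₀ = fun ξ => (2 * π)⁻¹ * ∫ t in (0:ℝ)..2 * π, u (Real.cos t • ξ + Real.sin t • perp ξ))
    (hu : Continuous u) (hρ : Continuous ρ) (hρ0 : ∀ ξ, 0 ≤ ρ ξ)
    (hρrad : ∀ ξ η : EuclideanSpace ℝ (Fin 2), ‖ξ‖ = ‖η‖ → ρ ξ = ρ η)
    (hint : Integrable fun ξ => ρ ξ * u ξ ^ 2) :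
    Integrable (fun ξ => ρ ξ * u₀ ξ ^ 2) ∧ ∫ ξ, ρ ξ * u₀ ξ ^ 2 ≤ ∫ ξ, ρ ξ * u ξ ^ 2 := by
  have hu₀c : Continuous u₀ := continuous_circularMean hu₀ hu
  refine integral_le_integral_of_forall_circle (hρ.mul (hu₀c.pow 2)) (hρ.mul (hu.pow 2))
    (fun ξ => mul_nonneg (hρ0 ξ) (sq_nonneg _)) (fun ξ => mul_nonneg (hρ0 ξ) (sq_nonneg _)) hint
    fun r hr => ?_
  have hρr : ∀ θ, ρ (toLp 2 ![r * Real.cos θ, r * Real.sin θ]) = ρ (toLp 2 ![r, 0]) := fun θ =>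
    hρrad _ _ (by rw [norm_toLp_cos_sin]; simpa using (norm_toLp_cos_sin r 0).symm)
  simp_rw [hρr, circularMean_circlePoint hu₀ r, intervalIntegral_circle_zero_two_pi_eq u r]
  rw [intervalIntegral.integral_const_mul, intervalIntegral.integral_const_mul, intervalIntegral.integral_const,
    smul_eq_mul]
  refine mul_le_mul_of_nonneg_left ?_ (hρ0 _)
  have hJ := Literature.Analysis.ODE.sq_intervalIntegral_le (hu.comp (continuous_toLp_cos_sin r) :
    Continuous fun θ => u (toLp 2 ![r * Real.cos θ, r * Real.sin θ])) (by linarith [pi_pos] : -π ≤ π)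
  simp only [Function.comp] at hJ
  rw [show π - -π = 2 * π by ring] at hJ ⊢
  rw [mul_pow, ← one_mul (∫ θ in (-π)..π, u (toLp 2 ![r * Real.cos θ, r * Real.sin θ]) ^ 2)]
  have h2π : (0:ℝ) < 2 * π := two_pi_pos
  calc 2 * π * (((2 * π)⁻¹) ^ 2 * (∫ θ in (-π)..π, u (toLp 2 ![r * Real.cos θ, r * Real.sin θ])) ^ 2)
      = (2 * π)⁻¹ * (∫ θ in (-π)..π, u (toLp 2 ![r * Real.cos θ, r * Real.sin θ])) ^ 2 := by
        field_simp
    _ ≤ (2 * π)⁻¹ * ((2 * π) * ∫ θ in (-π)..π, u (toLp 2 ![r * Real.cos θ, r * Real.sin θ]) ^ 2) :=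
        mul_le_mul_of_nonneg_left hJ (inv_nonneg.2 h2π.le)
    _ = 1 * ∫ θ in (-π)..π, u (toLp 2 ![r * Real.cos θ, r * Real.sin θ]) ^ 2 := by
        field_simp

/-- **T5′: `∫ ρ (u − u₀)² ≤ ∫ ρ u²`** for a continuous, nonnegative, radial weight `ρ` with `ρ u² ∈ L¹`
(on each circle, subtracting the mean does not increase the `L²` norm); in particular `ρ (u − u₀)² ∈ L¹`. [folklore] -/
theorem integral_mul_sub_circularMean_sq_le {u u₀ ρ : EuclideanSpace ℝ (Fin 2) → ℝ}
    (hu₀ : u₀ = fun ξ => (2 * π)⁻¹ * ∫ t in (0:ℝ)..2 * π, u (Real.cos t • ξ + Real.sin t • perp ξ))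
    (hu : Continuous u) (hρ : Continuous ρ) (hρ0 : ∀ ξ, 0 ≤ ρ ξ)
    (hρrad : ∀ ξ η : EuclideanSpace ℝ (Fin 2), ‖ξ‖ = ‖η‖ → ρ ξ = ρ η)
    (hint : Integrable fun ξ => ρ ξ * u ξ ^ 2) :
    Integrable (fun ξ => ρ ξ * (u ξ - u₀ ξ) ^ 2) ∧
      ∫ ξ, ρ ξ * (u ξ - u₀ ξ) ^ 2 ≤ ∫ ξ, ρ ξ * u ξ ^ 2 := by
  have hu₀c : Continuous u₀ := continuous_circularMean hu₀ hu
  refine integral_le_integral_of_forall_circle (hρ.mul ((hu.sub hu₀c).pow 2)) (hρ.mul (hu.pow 2))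
    (fun ξ => mul_nonneg (hρ0 ξ) (sq_nonneg _)) (fun ξ => mul_nonneg (hρ0 ξ) (sq_nonneg _)) hint
    fun r hr => ?_
  have hρr : ∀ θ, ρ (toLp 2 ![r * Real.cos θ, r * Real.sin θ]) = ρ (toLp 2 ![r, 0]) := fun θ =>
    hρrad _ _ (by rw [norm_toLp_cos_sin]; simpa using (norm_toLp_cos_sin r 0).symm)
  simp_rw [hρr, circularMean_circlePoint hu₀ r, intervalIntegral_circle_zero_two_pi_eq u r]
  rw [intervalIntegral.integral_const_mul, intervalIntegral.integral_const_mul]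
  refine mul_le_mul_of_nonneg_left ?_ (hρ0 _)
  have h := intervalIntegral_sub_mean_sq_le (hu.comp (continuous_toLp_cos_sin r) :
    Continuous fun θ => u (toLp 2 ![r * Real.cos θ, r * Real.sin θ])) (by linarith [pi_pos] : -π < π)
  simp only [Function.comp] at h
  rwa [show π - -π = 2 * π by ring] at h

end Summit.AnomalousDissipation.AnomalousDissipation.Theorems.MarginalStabilityChainStretchedVortexRows

end
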